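import Summits.BirchSwinnertonDyer.BirchSwinnertonDyer.Theorems.ClassRecordThreeEulerHalvesAtThreeHybridInertSavingServable
import Literature.NumberTheory.EllipticCurves.ModularityVersionApProofs
import HarnessLib

/-!
# Route `ClassRecordThree` (rung K2@3), crux 5 `EulerHalvesAtThree` (item stmt-BirchSwinnertonDyer-19109, shared by
# `KolyvaginRoadThree`): servability of the carrier-inert Shimura road with ANY NUMBER of split-multiplicative carrier
# primes — the IMC-grade residual of the line cut to «two non-split carriers, or one non-split carrier and three split ones»
# (cell `bsd-stepL`, seat `bsd-stepL-tam3-p1` g12, owner of the line; `--supports stmt-BirchSwinnertonDyer-19109 --as helper`)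

HONEST FRAMING: THEOREMS ONLY (no definition, no named fact, no `sorry`); pure finite bookkeeping on the reduction types
and Tamagawa numbers of ONE curve — nothing about `Ш`, no display, no BSD class theorem; no census label moves (T7); item
19109 is NOT closed. BSD is not proved by any of this.

WHAT. g11's sibling `…HybridInertSavingServable` proved that the two data bundles of the carrier-inert Shimura road at `3`
— INERT-SERVABLE (a (ram) witness, the SHAPE «every carrier prime is split multiplicative», an admissible even `S ∋ 3`) and
SAVING-SERVABLE (the same with ONE exempted bad prime `q₁ ∉ S`, Jetchev's saving being read at `q₁`) — are AUTOMATIC on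
X11b@3 curves with a (ram) witness `ℓ₀` and AT MOST ONE carrier prime `q ≠ 3` (`3 ∣ c_q(E)`), with `S = {3, ℓ₀}`; its
residual lemma `twoCarriers_of_ram_of_not_servable` left every curve with TWO carrier primes `≠ 3` to the IMC-grade
input CoS₃. Following corner-p1 g13's remark (STATUS 2026-08-28T00:15:57Z: a split-multiplicative carrier may be put
INTO `S`), this file serves every configuration of carriers with at most one NON-split carrier `≠ 3`, except one:
* `exists_finset_splitCarriers` — the finite set `B` of split-multiplicative primes `q ≠ 3` with `3 ∣ ord_q Δ_min`
  (= the split carriers, `c_q = ord_q Δ_min`), as a `Finset` (filter of the prime factors of the conductor);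
* `inertServable_of_ram_of_allSplit_of_even` — all carriers `≠ 3` split, `#B` even: INERT-servable with
  `S = {3, ℓ₀} ∪ B` (witness inside, Pasten Lemma 6.15);
* `inertSavingServable_of_ram_of_allSplitBut_of_even` — one exempted carrier `q₁ ≠ 3` (split or not), every OTHER
  carrier `≠ 3` split, `#(B \ {q₁})` even: SAVING-servable with `S = {3, ℓ₀} ∪ (B \ {q₁})`;
* `inertSavingServable_of_ram_of_allSplitBut_of_singleton` — the same with `B \ {q₁} = {b}`: SAVING-servable with
  `S = {3, b}` and the Papikian–Rabinoff half `R = {3}` (`3 ≠ 2`, `3 ∤ 2`; Pasten Lemma 6.18);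
* `residualShape_of_ram_of_not_servable` — the NEW residual: an X11b@3 curve with a (ram) witness that is neither
  inert- nor saving-servable has a NON-split carrier prime `q₀ ≠ 3` (by `split_or_typeIV_…` a place of type IV ∕ IV*
  with `c = 3`) AND (a second non-split carrier prime `≠ 3`, OR three distinct split-multiplicative carrier primes `≠ 3`).
  (All carriers split: `#B` even → inert-servable, `#B` odd → exempt one element of `B`; one non-split carrier `g`:
  exempt `g`, `#B` even → `S = {3, ℓ₀} ∪ B`, `#B = 1` → `S = {3, b}`; the parity obstruction `#B` odd `≥ 3` and two
  non-split carriers remain.)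
So after this file the IMC-grade binder of 19109's line is asked only under «¬(ram) ∨ two non-split (type IV∕IV*) carrier
primes ≠ 3 ∨ (a non-split carrier prime ≠ 3 ∧ three distinct split carrier primes ≠ 3)» — the composition is the sibling
`…HybridInertSavingManyCarriers.lean`. Census pointer (EVIDENCE, T7): 0 of the 568 TRUE-OPEN (T2′)@3 frames of the window
either way (every r2-residual frame has exactly one carrier prime `≠ 3`); the cut is CLASS-WIDE.

References: [PastenShimura2024] Lemmas 6.15, 6.18 (arXiv v4 p. 31); [SilvermanATAEC1994] Cor. IV.9.2(d), IV.9.4;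
[DiamondShurman2005] §8.3; [Jetchev2008] Thm. 1.1; [Kim2022HigherGZ] Rem. 7.9.
presearch: not applicable (finite bookkeeping over tree predicates); `lean search 'splitCarriers|allSplitBut|residualShape_of_ram'` → none.
-/

noncomputable section

open scoped Classical NumberField

namespace Summit.BirchSwinnertonDyer.Rank1Residual.X11b.Three.Koly

open WeierstrassCurve NumberField IsDedekindDomain Field Literature.NumberTheory.EllipticCurves
  Literature.NumberTheory.EllipticCurves.Rank1Residual Literature.NumberTheory.EllipticCurves.Rank1Residual.Typed
  Summit.BirchSwinnertonDyer.Rank1Residual Summit.BirchSwinnertonDyer.Rank1Residual.X11b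
  Summit.BirchSwinnertonDyer.BirchSwinnertonDyer.Theorems

/-! ### §1 The finite set of split-multiplicative carrier primes `≠ 3` -/

/-- **The split carriers as a `Finset`.** For `E = W/ℚ` there is a finite set `B ⊆ ℕ` whose members are exactly the primes
`q ≠ 3` at which `E` is split multiplicative with `3 ∣ ord_q Δ_min` (equivalently `3 ∣ c_q(E)`): the filter of the prime
factors of the conductor (a multiplicative prime divides `N_E`). [cite: DiamondShurman2005, §8.3] -/
theorem exists_finset_splitCarriers (W : WeierstrassCurve ℚ) [W.IsElliptic] [W.IsGloballyMinimal] :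
    ∃ B : Finset ℕ, ∀ q : ℕ, q ∈ B ↔ ∃ _ : Fact q.Prime, q ≠ 3 ∧ W.HasSplitMultiplicativeReductionAtPrime q ∧
      3 ∣ padicValInt q W.minimalDiscriminantInt := by
  refine ⟨(W.conductorNorm ℤ).primeFactors.filter (fun q ↦ ∃ _ : Fact q.Prime, q ≠ 3 ∧
    W.HasSplitMultiplicativeReductionAtPrime q ∧ 3 ∣ padicValInt q W.minimalDiscriminantInt), fun q ↦ ?_⟩
  rw [Finset.mem_filter, Nat.mem_primeFactors]
  constructor
  · exact fun h ↦ h.2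
  · rintro ⟨hqF, hq3, hs, hv⟩
    haveI := hqF
    refine ⟨⟨hqF.out, ?_, (W.conductorNorm_pos_holds).ne'⟩, hqF, hq3, hs, hv⟩
    exact (W.dvd_conductorNorm_iff_not_hasGoodReductionAtPrime q).mpr
      (WeierstrassCurve.HasMultiplicativeReduction.not_hasGoodReduction (R := ℤ_[q])
        hs.hasMultiplicativeReductionAtPrime)

/-! ### §2 Servability with any number of split carriers -/

/-- **INERT-servability with every carrier split and an even number of split carriers `≠ 3`.** On an X11b@3 curve with a
(ram) witness `ℓ₀`, if every prime `q` with `3 ∣ c_q(E)` is split multiplicative and the set `B` of split carriers `≠ 3`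
has even cardinality, g9's inert-servable bundle holds with `S = {3, ℓ₀} ∪ B` (multiplicative, even, `3 ∈ S`, every split
`ℓ ∉ S` has `3 ∤ ord_ℓ Δ_min`, witness `ℓ₀ ∈ S`). [cite: PastenShimura2024, Lemma 6.15 (arXiv v4 p. 31)] -/
theorem inertServable_of_ram_of_allSplit_of_even
    (W : WeierstrassCurve ℚ) [W.IsElliptic] [W.IsGloballyMinimal] (hX : ClassX11b W 3) (hram : Ram W 3)
    (hall : ∀ (q : ℕ) [Fact q.Prime], 3 ∣ (W.baseChange ℚ_[q]).localTamagawaNumber ℤ_[q] →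
      W.HasSplitMultiplicativeReductionAtPrime q)
    (B : Finset ℕ)
    (hB : ∀ q : ℕ, q ∈ B ↔ ∃ _ : Fact q.Prime, q ≠ 3 ∧ W.HasSplitMultiplicativeReductionAtPrime q ∧
      3 ∣ padicValInt q W.minimalDiscriminantInt)
    (heven : Even B.card) :
    Ram W 3 ∧
      (∀ (q : ℕ) [Fact q.Prime], 3 ∣ (W.baseChange ℚ_[q]).localTamagawaNumber ℤ_[q] →
        W.HasSplitMultiplicativeReductionAtPrime q) ∧
      ∃ S : Finset ℕ, (∀ ℓ ∈ S, ∃ _ : Fact ℓ.Prime, Mult W ℓ) ∧ Even S.card ∧ 3 ∈ S ∧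
        (∀ (ℓ : ℕ) [Fact ℓ.Prime], ℓ ∉ S → W.HasSplitMultiplicativeReductionAtPrime ℓ →
          ¬ 3 ∣ padicValInt ℓ W.minimalDiscriminantInt) ∧
        ((∃ (ℓ₁ : ℕ) (_ : Fact ℓ₁.Prime), Mult W ℓ₁ ∧ ¬ 3 ∣ padicValInt ℓ₁ W.minimalDiscriminantInt ∧
            (ℓ₁ ∈ S ∨ ∃ (t : ℕ) (_ : Fact t.Prime), Mult W t ∧ t ∉ S ∧ t ≠ ℓ₁)) ∨
          ∃ R ⊆ S, S.card = 2 * R.card ∧ ∀ q ∈ R, q ≠ 2 ∧ ¬ 3 ∣ q - 1) := by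
  obtain ⟨-, -, hmult3, -⟩ := id hX
  obtain ⟨ℓ₀, hℓ₀F, hℓ₀3, hmult₀, hram₀⟩ := hram
  haveI := hℓ₀F
  have h3B : 3 ∉ B := fun h ↦ by obtain ⟨_, h3, -⟩ := (hB 3).mp h; exact h3 rfl
  have hℓ₀B : ℓ₀ ∉ B := fun h ↦ by obtain ⟨_, -, -, hv⟩ := (hB ℓ₀).mp h; exact hram₀ hv
  have hℓ₀S' : ℓ₀ ∉ B := hℓ₀B
  have h3S' : (3 : ℕ) ∉ insert ℓ₀ B := by
    rw [Finset.mem_insert, not_or]; exact ⟨Ne.symm hℓ₀3, h3B⟩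
  refine ⟨⟨ℓ₀, hℓ₀F, hℓ₀3, hmult₀, hram₀⟩, fun q _ h ↦ hall q h, insert 3 (insert ℓ₀ B), ?_, ?_, by simp, ?_,
    Or.inl ⟨ℓ₀, hℓ₀F, hmult₀, hram₀, Or.inl (by simp)⟩⟩
  · intro ℓ hℓ
    rcases Finset.mem_insert.mp hℓ with rfl | hℓ
    · exact ⟨⟨Nat.prime_three⟩, hmult3⟩
    · rcases Finset.mem_insert.mp hℓ with rfl | hℓ
      · exact ⟨hℓ₀F, hmult₀⟩
      · obtain ⟨hF, -, hs, -⟩ := (hB ℓ).mp hℓ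
        exact ⟨hF, hs.hasMultiplicativeReductionAtPrime⟩
  · rw [Finset.card_insert_of_notMem h3S', Finset.card_insert_of_notMem hℓ₀S']
    obtain ⟨r, hr⟩ := heven
    exact ⟨r + 1, by omega⟩
  · intro ℓ _ hℓS hs hv
    have hℓ3 : ℓ ≠ 3 := fun h ↦ hℓS (by simp [h])
    exact hℓS (Finset.mem_insert_of_mem (Finset.mem_insert_of_mem ((hB ℓ).mpr ⟨‹_›, hℓ3, hs, hv⟩)))

/-- **SAVING-servability with one exempted carrier and an even number of OTHER split carriers `≠ 3`.** On an X11b@3 curve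
with a (ram) witness `ℓ₀` and a carrier prime `q₁ ≠ 3` (`3 ∣ c_{q₁}(E)`, split or not), if every OTHER prime `q ≠ q₁` with
`3 ∣ c_q(E)` is split multiplicative and `B \ {q₁}` (the other split carriers `≠ 3`) has even cardinality, g11's
saving-servable bundle holds with the exempted prime `q₁` and `S = {3, ℓ₀} ∪ (B \ {q₁})`.
[cite: PastenShimura2024, Lemma 6.15 (arXiv v4 p. 31)] [cite: Jetchev2008, Thm. 1.1] -/
theorem inertSavingServable_of_ram_of_allSplitBut_of_even
    (W : WeierstrassCurve ℚ) [W.IsElliptic] [W.IsGloballyMinimal] (hX : ClassX11b W 3) (hram : Ram W 3)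
    (q₁ : ℕ) [hq₁ : Fact q₁.Prime] (hq₁3 : q₁ ≠ 3) (hc₁ : 3 ∣ (W.baseChange ℚ_[q₁]).localTamagawaNumber ℤ_[q₁])
    (hall : ∀ (q : ℕ) [Fact q.Prime], q ≠ 3 → q ≠ q₁ → 3 ∣ (W.baseChange ℚ_[q]).localTamagawaNumber ℤ_[q] →
      W.HasSplitMultiplicativeReductionAtPrime q)
    (B : Finset ℕ)
    (hB : ∀ q : ℕ, q ∈ B ↔ ∃ _ : Fact q.Prime, q ≠ 3 ∧ W.HasSplitMultiplicativeReductionAtPrime q ∧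
      3 ∣ padicValInt q W.minimalDiscriminantInt)
    (heven : Even (B.erase q₁).card) :
    Ram W 3 ∧ ∃ (q₁ : ℕ) (_ : Fact q₁.Prime), ¬ W.HasGoodReductionAtPrime q₁ ∧
      (∀ (q : ℕ) [Fact q.Prime], q ≠ q₁ → 3 ∣ (W.baseChange ℚ_[q]).localTamagawaNumber ℤ_[q] →
        W.HasSplitMultiplicativeReductionAtPrime q) ∧
      ∃ S : Finset ℕ, (∀ ℓ ∈ S, ∃ _ : Fact ℓ.Prime, Mult W ℓ) ∧ Even S.card ∧ 3 ∈ S ∧ q₁ ∉ S ∧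
        (∀ (ℓ : ℕ) [Fact ℓ.Prime], ℓ ∉ S → ℓ ≠ q₁ → W.HasSplitMultiplicativeReductionAtPrime ℓ →
          ¬ 3 ∣ padicValInt ℓ W.minimalDiscriminantInt) ∧
        ((∃ (ℓ₁ : ℕ) (_ : Fact ℓ₁.Prime), Mult W ℓ₁ ∧ ¬ 3 ∣ padicValInt ℓ₁ W.minimalDiscriminantInt ∧
            (ℓ₁ ∈ S ∨ ∃ (t : ℕ) (_ : Fact t.Prime), Mult W t ∧ t ∉ S ∧ t ≠ ℓ₁)) ∨
          ∃ R ⊆ S, S.card = 2 * R.card ∧ ∀ q ∈ R, q ≠ 2 ∧ ¬ 3 ∣ q - 1) := by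
  obtain ⟨-, -, hmult3, -⟩ := id hX
  obtain ⟨ℓ₀, hℓ₀F, hℓ₀3, hmult₀, hram₀⟩ := hram
  haveI := hℓ₀F
  have hq₁ℓ₀ : q₁ ≠ ℓ₀ := by
    rintro rfl
    exact hram₀ (split_and_three_dvd_of_mult_of_three_dvd_localTamagawaNumber W q₁ hmult₀ hc₁).2
  set B' : Finset ℕ := B.erase q₁ with hB'def
  have h3B' : 3 ∉ B' := fun h ↦ by
    obtain ⟨_, h3, -⟩ := (hB 3).mp (Finset.mem_of_mem_erase h); exact h3 rfl
  have hℓ₀B' : ℓ₀ ∉ B' := fun h ↦ by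
    obtain ⟨_, -, -, hv⟩ := (hB ℓ₀).mp (Finset.mem_of_mem_erase h); exact hram₀ hv
  have h3S' : (3 : ℕ) ∉ insert ℓ₀ B' := by
    rw [Finset.mem_insert, not_or]; exact ⟨Ne.symm hℓ₀3, h3B'⟩
  refine ⟨⟨ℓ₀, hℓ₀F, hℓ₀3, hmult₀, hram₀⟩, q₁, hq₁, ?_, ?_, insert 3 (insert ℓ₀ B'), ?_, ?_, by simp, ?_, ?_,
    Or.inl ⟨ℓ₀, hℓ₀F, hmult₀, hram₀, Or.inl (by simp)⟩⟩
  · -- `q₁` is bad: at a good prime `c = 1`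
    intro hgood
    haveI : (W.baseChange ℚ_[q₁]).IsElliptic := inferInstanceAs (W.map (algebraMap ℚ ℚ_[q₁])).IsElliptic
    have hc1 : (W.baseChange ℚ_[q₁]).localTamagawaNumber ℤ_[q₁] = 1 := by
      haveI : ((W.baseChange ℚ_[q₁]).minimal ℤ_[q₁]).HasGoodReduction ℤ_[q₁] := hgood
      exact localTamagawaNumber_eq_one_of_hasGoodReduction_holds ℤ_[q₁] _
    rw [hc1] at hc₁
    exact absurd (Nat.le_of_dvd one_pos hc₁) (by decide)
  · -- the SHAPE off `q₁`
    intro q _ hq h3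
    by_cases hq3 : q = 3
    · subst hq3
      exact (split_and_three_dvd_of_mult_of_three_dvd_localTamagawaNumber W 3 hmult3 h3).1
    · exact hall q hq3 hq h3
  · intro ℓ hℓ
    rcases Finset.mem_insert.mp hℓ with rfl | hℓ
    · exact ⟨⟨Nat.prime_three⟩, hmult3⟩
    · rcases Finset.mem_insert.mp hℓ with rfl | hℓ
      · exact ⟨hℓ₀F, hmult₀⟩
      · obtain ⟨hF, -, hs, -⟩ := (hB ℓ).mp (Finset.mem_of_mem_erase hℓ)
        exact ⟨hF, hs.hasMultiplicativeReductionAtPrime⟩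
  · rw [Finset.card_insert_of_notMem h3S', Finset.card_insert_of_notMem hℓ₀B']
    obtain ⟨r, hr⟩ := heven
    exact ⟨r + 1, by omega⟩
  · simp only [Finset.mem_insert, not_or, hB'def, Finset.mem_erase, ne_eq, not_true_eq_false, false_and,
      not_false_eq_true, and_true]
    exact ⟨hq₁3, hq₁ℓ₀⟩
  · intro ℓ _ hℓS hℓq₁ hs hv
    have hℓ3 : ℓ ≠ 3 := fun h ↦ hℓS (by simp [h])
    exact hℓS (Finset.mem_insert_of_mem (Finset.mem_insert_of_mem
      (Finset.mem_erase.mpr ⟨hℓq₁, (hB ℓ).mpr ⟨‹_›, hℓ3, hs, hv⟩⟩)))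

/-- **SAVING-servability with one exempted carrier and exactly ONE other split carrier `b ≠ 3`.** As the previous theorem,
with `B \ {q₁} = {b}`: the bundle holds with the exempted prime `q₁` and `S = {3, b}`, the (DEG) datum being the
Papikian–Rabinoff half `R = {3}` (`3 ≠ 2`, `3 ∤ 3 − 1`) — corner-p1 g13's «`R = {3}` always qualifies».
[cite: PastenShimura2024, Lemma 6.18 (arXiv v4 p. 31)] [cite: Jetchev2008, Thm. 1.1] -/
theorem inertSavingServable_of_ram_of_allSplitBut_of_singleton
    (W : WeierstrassCurve ℚ) [W.IsElliptic] [W.IsGloballyMinimal] (hX : ClassX11b W 3) (hram : Ram W 3)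
    (q₁ : ℕ) [hq₁ : Fact q₁.Prime] (hq₁3 : q₁ ≠ 3) (hc₁ : 3 ∣ (W.baseChange ℚ_[q₁]).localTamagawaNumber ℤ_[q₁])
    (hall : ∀ (q : ℕ) [Fact q.Prime], q ≠ 3 → q ≠ q₁ → 3 ∣ (W.baseChange ℚ_[q]).localTamagawaNumber ℤ_[q] →
      W.HasSplitMultiplicativeReductionAtPrime q)
    (B : Finset ℕ)
    (hB : ∀ q : ℕ, q ∈ B ↔ ∃ _ : Fact q.Prime, q ≠ 3 ∧ W.HasSplitMultiplicativeReductionAtPrime q ∧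
      3 ∣ padicValInt q W.minimalDiscriminantInt)
    (b : ℕ) (hb : B.erase q₁ = {b}) :
    Ram W 3 ∧ ∃ (q₁ : ℕ) (_ : Fact q₁.Prime), ¬ W.HasGoodReductionAtPrime q₁ ∧
      (∀ (q : ℕ) [Fact q.Prime], q ≠ q₁ → 3 ∣ (W.baseChange ℚ_[q]).localTamagawaNumber ℤ_[q] →
        W.HasSplitMultiplicativeReductionAtPrime q) ∧
      ∃ S : Finset ℕ, (∀ ℓ ∈ S, ∃ _ : Fact ℓ.Prime, Mult W ℓ) ∧ Even S.card ∧ 3 ∈ S ∧ q₁ ∉ S ∧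
        (∀ (ℓ : ℕ) [Fact ℓ.Prime], ℓ ∉ S → ℓ ≠ q₁ → W.HasSplitMultiplicativeReductionAtPrime ℓ →
          ¬ 3 ∣ padicValInt ℓ W.minimalDiscriminantInt) ∧
        ((∃ (ℓ₁ : ℕ) (_ : Fact ℓ₁.Prime), Mult W ℓ₁ ∧ ¬ 3 ∣ padicValInt ℓ₁ W.minimalDiscriminantInt ∧
            (ℓ₁ ∈ S ∨ ∃ (t : ℕ) (_ : Fact t.Prime), Mult W t ∧ t ∉ S ∧ t ≠ ℓ₁)) ∨
          ∃ R ⊆ S, S.card = 2 * R.card ∧ ∀ q ∈ R, q ≠ 2 ∧ ¬ 3 ∣ q - 1) := by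
  obtain ⟨-, -, hmult3, -⟩ := id hX
  have hbB' : b ∈ B.erase q₁ := by rw [hb]; exact Finset.mem_singleton_self b
  obtain ⟨hbF, hb3, hsb, -⟩ := (hB b).mp (Finset.mem_of_mem_erase hbB')
  haveI := hbF
  have hbq₁ : b ≠ q₁ := (Finset.mem_erase.mp hbB').1
  refine ⟨hram, q₁, hq₁, ?_, ?_, {3, b}, ?_, ?_, by simp, ?_, ?_, Or.inr ⟨{3}, by simp, ?_, ?_⟩⟩
  · -- `q₁` is bad: at a good prime `c = 1`
    intro hgood
    haveI : (W.baseChange ℚ_[q₁]).IsElliptic := inferInstanceAs (W.map (algebraMap ℚ ℚ_[q₁])).IsElliptic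
    have hc1 : (W.baseChange ℚ_[q₁]).localTamagawaNumber ℤ_[q₁] = 1 := by
      haveI : ((W.baseChange ℚ_[q₁]).minimal ℤ_[q₁]).HasGoodReduction ℤ_[q₁] := hgood
      exact localTamagawaNumber_eq_one_of_hasGoodReduction_holds ℤ_[q₁] _
    rw [hc1] at hc₁
    exact absurd (Nat.le_of_dvd one_pos hc₁) (by decide)
  · -- the SHAPE off `q₁`
    intro q _ hq h3
    by_cases hq3 : q = 3
    · subst hq3
      exact (split_and_three_dvd_of_mult_of_three_dvd_localTamagawaNumber W 3 hmult3 h3).1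
    · exact hall q hq3 hq h3
  · intro ℓ hℓ
    rcases Finset.mem_insert.mp hℓ with rfl | hℓ
    · exact ⟨⟨Nat.prime_three⟩, hmult3⟩
    · rw [Finset.mem_singleton] at hℓ
      subst hℓ
      exact ⟨hbF, hsb.hasMultiplicativeReductionAtPrime⟩
  · rw [Finset.card_pair (Ne.symm hb3)]
    exact even_two
  · simp only [Finset.mem_insert, Finset.mem_singleton, not_or]
    exact ⟨hq₁3, Ne.symm hbq₁⟩
  · intro ℓ _ hℓS hℓq₁ hs hv
    have hℓ3 : ℓ ≠ 3 := fun h ↦ hℓS (by simp [h])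
    have hℓB' : ℓ ∈ B.erase q₁ := Finset.mem_erase.mpr ⟨hℓq₁, (hB ℓ).mpr ⟨‹_›, hℓ3, hs, hv⟩⟩
    rw [hb, Finset.mem_singleton] at hℓB'
    exact hℓS (by simp [hℓB'])
  · rw [Finset.card_pair (Ne.symm hb3), Finset.card_singleton]
  · intro q hq
    rw [Finset.mem_singleton] at hq
    subst hq
    decide

/-! ### §3 The new residual SHAPE -/

/-- **The residual SHAPE of 19109's line after the many-carrier cut.** An X11b@3 curve with a (ram) witness that is
neither inert-servable (g9's bundle) nor saving-servable (g11's bundle) has a carrier prime `q₀ ≠ 3` that is NOT split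
multiplicative (a place of Kodaira type IV ∕ IV* with `c = 3`) AND EITHER a second such prime OR three distinct
split-multiplicative carrier primes `≠ 3`. Proof: with `B` the split carriers `≠ 3` — no non-split carrier: `#B` even is
inert-servable, `#B` odd is saving-servable exempting one element of `B`; exactly one non-split carrier `g`: exempt `g`,
`#B` even or `#B = 1` is saving-servable; there remain two non-split carriers, or one with `#B` odd `≥ 3`. [folklore] -/
theorem residualShape_of_ram_of_not_servable
    (W : WeierstrassCurve ℚ) [W.IsElliptic] [W.IsGloballyMinimal] (hX : ClassX11b W 3) (hram : Ram W 3)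
    (hserv : ¬ (Ram W 3 ∧
      (∀ (q : ℕ) [Fact q.Prime], 3 ∣ (W.baseChange ℚ_[q]).localTamagawaNumber ℤ_[q] →
        W.HasSplitMultiplicativeReductionAtPrime q) ∧
      ∃ S : Finset ℕ, (∀ ℓ ∈ S, ∃ _ : Fact ℓ.Prime, Mult W ℓ) ∧ Even S.card ∧ 3 ∈ S ∧
        (∀ (ℓ : ℕ) [Fact ℓ.Prime], ℓ ∉ S → W.HasSplitMultiplicativeReductionAtPrime ℓ →
          ¬ 3 ∣ padicValInt ℓ W.minimalDiscriminantInt) ∧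
        ((∃ (ℓ₁ : ℕ) (_ : Fact ℓ₁.Prime), Mult W ℓ₁ ∧ ¬ 3 ∣ padicValInt ℓ₁ W.minimalDiscriminantInt ∧
            (ℓ₁ ∈ S ∨ ∃ (t : ℕ) (_ : Fact t.Prime), Mult W t ∧ t ∉ S ∧ t ≠ ℓ₁)) ∨
          ∃ R ⊆ S, S.card = 2 * R.card ∧ ∀ q ∈ R, q ≠ 2 ∧ ¬ 3 ∣ q - 1)))
    (hsav : ¬ (Ram W 3 ∧ ∃ (q₁ : ℕ) (_ : Fact q₁.Prime), ¬ W.HasGoodReductionAtPrime q₁ ∧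
      (∀ (q : ℕ) [Fact q.Prime], q ≠ q₁ → 3 ∣ (W.baseChange ℚ_[q]).localTamagawaNumber ℤ_[q] →
        W.HasSplitMultiplicativeReductionAtPrime q) ∧
      ∃ S : Finset ℕ, (∀ ℓ ∈ S, ∃ _ : Fact ℓ.Prime, Mult W ℓ) ∧ Even S.card ∧ 3 ∈ S ∧ q₁ ∉ S ∧
        (∀ (ℓ : ℕ) [Fact ℓ.Prime], ℓ ∉ S → ℓ ≠ q₁ → W.HasSplitMultiplicativeReductionAtPrime ℓ →
          ¬ 3 ∣ padicValInt ℓ W.minimalDiscriminantInt) ∧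
        ((∃ (ℓ₁ : ℕ) (_ : Fact ℓ₁.Prime), Mult W ℓ₁ ∧ ¬ 3 ∣ padicValInt ℓ₁ W.minimalDiscriminantInt ∧
            (ℓ₁ ∈ S ∨ ∃ (t : ℕ) (_ : Fact t.Prime), Mult W t ∧ t ∉ S ∧ t ≠ ℓ₁)) ∨
          ∃ R ⊆ S, S.card = 2 * R.card ∧ ∀ q ∈ R, q ≠ 2 ∧ ¬ 3 ∣ q - 1))) :
    ∃ (q₀ : ℕ) (_ : Fact q₀.Prime), q₀ ≠ 3 ∧ 3 ∣ (W.baseChange ℚ_[q₀]).localTamagawaNumber ℤ_[q₀] ∧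
      ¬ W.HasSplitMultiplicativeReductionAtPrime q₀ ∧
      ((∃ (q₀' : ℕ) (_ : Fact q₀'.Prime), q₀' ≠ 3 ∧ q₀' ≠ q₀ ∧
          3 ∣ (W.baseChange ℚ_[q₀']).localTamagawaNumber ℤ_[q₀'] ∧ ¬ W.HasSplitMultiplicativeReductionAtPrime q₀') ∨
        ∃ (b₁ b₂ b₃ : ℕ) (_ : Fact b₁.Prime) (_ : Fact b₂.Prime) (_ : Fact b₃.Prime),
          b₁ ≠ 3 ∧ b₂ ≠ 3 ∧ b₃ ≠ 3 ∧ b₁ ≠ b₂ ∧ b₁ ≠ b₃ ∧ b₂ ≠ b₃ ∧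
          W.HasSplitMultiplicativeReductionAtPrime b₁ ∧ W.HasSplitMultiplicativeReductionAtPrime b₂ ∧
          W.HasSplitMultiplicativeReductionAtPrime b₃ ∧
          3 ∣ (W.baseChange ℚ_[b₁]).localTamagawaNumber ℤ_[b₁] ∧
          3 ∣ (W.baseChange ℚ_[b₂]).localTamagawaNumber ℤ_[b₂] ∧
          3 ∣ (W.baseChange ℚ_[b₃]).localTamagawaNumber ℤ_[b₃]) := by
  obtain ⟨B, hB⟩ := exists_finset_splitCarriers W
  -- members of `B` are carriers
  have hBc : ∀ q ∈ B, ∃ _ : Fact q.Prime, q ≠ 3 ∧ W.HasSplitMultiplicativeReductionAtPrime q ∧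
      3 ∣ (W.baseChange ℚ_[q]).localTamagawaNumber ℤ_[q] := by
    intro q hq
    obtain ⟨hF, hq3, hs, hv⟩ := (hB q).mp hq
    exact ⟨hF, hq3, hs, @three_dvd_localTamagawaNumber_of_split_of_three_dvd W _ _ q hF hs hv⟩
  by_contra hno
  push Not at hno
  by_cases hΓ : ∀ (q : ℕ) [Fact q.Prime], q ≠ 3 → 3 ∣ (W.baseChange ℚ_[q]).localTamagawaNumber ℤ_[q] →
      W.HasSplitMultiplicativeReductionAtPrime q
  · -- no non-split carrier: parity of `#B`
    have hall : ∀ (q : ℕ) [Fact q.Prime], 3 ∣ (W.baseChange ℚ_[q]).localTamagawaNumber ℤ_[q] →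
        W.HasSplitMultiplicativeReductionAtPrime q := by
      intro q _ h3
      by_cases hq3 : q = 3
      · subst hq3
        exact (split_and_three_dvd_of_mult_of_three_dvd_localTamagawaNumber W 3 hX.2.2.1 h3).1
      · exact hΓ q hq3 h3
    rcases Nat.even_or_odd B.card with heven | hodd
    · exact hserv (inertServable_of_ram_of_allSplit_of_even W hX hram hall B hB heven)
    · -- exempt one element of `B`
      have hne : B.Nonempty := Finset.card_pos.mp hodd.pos
      obtain ⟨b₀, hb₀⟩ := hne
      obtain ⟨hb₀F, hb₀3, -, hc₀⟩ := hBc b₀ hb₀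
      haveI := hb₀F
      have heven : Even (B.erase b₀).card := by
        rw [Finset.card_erase_of_mem hb₀]
        obtain ⟨r, hr⟩ := hodd
        exact ⟨r, by omega⟩
      exact hsav (inertSavingServable_of_ram_of_allSplitBut_of_even W hX hram b₀ hb₀3 hc₀
        (fun q _ hq3 _ h3 ↦ hΓ q hq3 h3) B hB heven)
  · -- a non-split carrier `g`
    push Not at hΓ
    obtain ⟨g, hgF, hg3, hcg, hgs⟩ := hΓ
    haveI := hgF
    -- by `hno`, `g` is the ONLY non-split carrier `≠ 3`, and `B` has no three distinct elements
    have huniq : ∀ (q : ℕ) [Fact q.Prime], q ≠ 3 → q ≠ g → 3 ∣ (W.baseChange ℚ_[q]).localTamagawaNumber ℤ_[q] →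
        W.HasSplitMultiplicativeReductionAtPrime q := by
      intro q _ hq3 hqg h3
      exact (hno g hgF hg3 hcg hgs).1 q ‹_› hq3 hqg h3
    have hgB : g ∉ B := fun h ↦ by obtain ⟨_, -, hs, -⟩ := (hB g).mp h; exact hgs hs
    have hBg : B.erase g = B := Finset.erase_eq_of_notMem hgB
    rcases Nat.even_or_odd B.card with heven | hodd
    · exact hsav (inertSavingServable_of_ram_of_allSplitBut_of_even W hX hram g hg3 hcg
        (fun q _ hq3 hqg h3 ↦ huniq q hq3 hqg h3) B hB (by rwa [hBg]))
    · by_cases h1 : B.card = 1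
      · obtain ⟨b, hb⟩ := Finset.card_eq_one.mp h1
        exact hsav (inertSavingServable_of_ram_of_allSplitBut_of_singleton W hX hram g hg3 hcg
          (fun q _ hq3 hqg h3 ↦ huniq q hq3 hqg h3) B hB b (by rw [hBg, hb]))
      · -- `#B` odd and `≠ 1`: three distinct split carriers
        have h3le : 2 < B.card := by obtain ⟨r, hr⟩ := hodd; omega
        obtain ⟨b₁, b₂, b₃, hb₁, hb₂, hb₃, h12, h13, h23⟩ := Finset.two_lt_card_iff.mp h3le
        obtain ⟨F₁, hb₁3, hs₁, hc₁⟩ := hBc b₁ hb₁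
        obtain ⟨F₂, hb₂3, hs₂, hc₂⟩ := hBc b₂ hb₂
        obtain ⟨F₃, hb₃3, hs₃, hc₃⟩ := hBc b₃ hb₃
        exact (hno g hgF hg3 hcg hgs).2 b₁ b₂ b₃ F₁ F₂ F₃ hb₁3 hb₂3 hb₃3 h12 h13 h23 hs₁ hs₂ hs₃ hc₁ hc₂ hc₃

end Summit.BirchSwinnertonDyer.Rank1Residual.X11b.Three.Koly

end
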